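import Summits.BirchSwinnertonDyer.Rank1Residual.X2.NonsplitBDPValueDisplayRescale
import Summits.BirchSwinnertonDyer.Rank1Residual.X11b.AnticyclotomicEmbedding
import Literature.NumberTheory.GaloisRepresentations.WeilLAdicCharacterLocalShape
import Literature.NumberTheory.GaloisRepresentations.LocalArtinMapPinned
import Literature.NumberTheory.Automorphic.AdicCompletionLocalField
import HarnessLib

/-!
# The `p`-adic avatar of an interpolation character AT A PRIME ABOVE `p`: local–global
# compatibility for ANY avatar, and the limit `ι⁻¹(φ_k(ϖ_𝔭))·p^{−S n_k} → 1` along interpolation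
# sequences — lemma 3 (at `𝔭`) of the kernel rescale `lzz_rescale` (cell `bsd-eis`, seat
# `bsd-eis-k5-c4` g7; route `EisensteinPrimes`, crux 4 `BSDpOnCellC` = stmt-BirchSwinnertonDyer-19034,
# line b1 v9 f9bf0946, `stub_c2` at `p = 3`; RULING L43 (2) «COMMISSION (O2)-LZZ@3», kernel side;
# cgshw MEMO-18 §5)

HONEST FRAMING (cell `bsd-eis`): theorems only; nothing booked; no label or count moves; BSD is not proved.

## Why

A `p`-adic Waldspurger formula printed with the local ROOT NUMBER at the distinguished prime `𝔭 ∣ p`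
(Liu–Zhang–Zhang, Duke Math. J. 167 (2018) Thm. 3.2.10: the factor `ε(½,ψ,π_𝔭 ⊗ χ̌_{𝔓^c})/L(½,…)²`,
for the Steinberg component `St ⊗ μ₀`, `μ₀(p) = a_p`, at an unramified character: `ε_k/L_k²` with
`L_k⁻¹ = 1 − a_p p⁻¹ φ_k(ϖ_𝔭)`, `ε_k = −a_p·φ_k(ϖ_𝔭)`) carries, besides the Euler factor `L_k⁻²` that the
tree's display `bdpInterpolationValue` also has, the value `φ_k(ϖ_𝔭)` of the interpolation character at
a uniformizer OF `𝔭` itself, read in `ℂ_p` through `ι⁻¹` (`p`-adic valuation `n_k`). A kernel rescale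
of such a formula to the cell's continuous-function display (`X2.BDPValueContinuousDisplayAt`; pointwise
contract `bdpValueContinuousDisplayAt_of_pointwise`) needs the behaviour of `ι⁻¹(φ_k(ϖ_𝔭))` along an
interpolation sequence `(φ_k, n_k, r_k)` through the anticyclotomic `Γ` with `r_k(γ) → 1`. The sister
lemma `PNewDisplay.tendsto_symm_valueAtUniformizer` (`X2/NonsplitBDPValueDisplayRescale.lean` §3) treats
`v ∤ p` by Frobenius elements — `IsPAdicAvatarOf` speaks ONLY about Frobenius characteristic polynomials
away from `p` — and says nothing at `𝔭`. This file supplies the statement at `𝔭`: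

* §1 `eq_lAdicAvatar_inv_of_isPAdicAvatarOf` — **`Ψ_r = ψ_p⁻¹` for ANY avatar**: an idelic character
  of an avatar `r` of the algebraic Hecke character `φ` (the clauses of
  `FramedGaloisRep.exists_idelicCharacter`) is the inverse of Weil's `p`-adic avatar
  `HasInfinityType.lAdicAvatar` of `φ` (Serre, *Abelian ℓ-adic representations* II §2.7): the proof of
  the tree's `HasInfinityType.eq_lAdicAvatar_inv` (stated there for Weil's own character `weilRep`)
  with the Frobenius clause supplied by `IsPAdicAvatarOf` — rigidity of idele class characters
  (`ContinuousMonoidHom.idele_eq_of_forall_localUnits`).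
* §2 `avatar_entry_eq_of_isPAdicAvatarOf` — **local–global compatibility at `v ∣ p` for any avatar**:
  `r(res_v w) = ι⁻¹(φ(⟨a w⟩_v)) · ∏_{e : K_v → ℚ̄_p} e(a w)^{−n_e}` for every local Artin map `a` and
  `w ∈ W_{K_v}` (Serre III §2.3 «`ρ_ℓ` is locally algebraic»), from
  `FramedGaloisRep.exists_idelicCharacter_localGlobal` and §1.
* §3 `exists_avatarValueAt_eq_symm_map_localUnits_mul_zpow` — evaluating at `w₀` with `a(w₀) = p`
  (surjectivity clause of `IsLocalArtinMap`, `exists_isLocalArtinMap_holds`): EVERY local embedding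
  sends `p ↦ p`, and for the infinity type `(n, −n)` every exponent is `±n`, so the algebraic part is
  `p^{−n·S}` with `S ∈ ℤ` FIXED (depending on `ι` and `v` only — SIGN-FREE: no identification of the
  local embedding with `w.embedding` is needed); hence a FIXED `σ₀ ∈ Γ_K` with
  `r(σ₀) = ι⁻¹(φ(⟨p⟩_v)) · p^{−n S}` for all unramified `φ` of type `(n, −n)` and all avatars `r`.
* §4 `valuation_natCast_eq_exp_neg_ramificationIdx`, `…map_localUnits_natCast_eq_valueAtUniformizer_zpow`
  — `⟨p⟩_v` has valuation `q_v^{−e(v|p)}`, so `φ(⟨p⟩_v) = φ(ϖ_v)^{e(v|p)}` for unramified `φ`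
  (`IsUnramifiedAt.coe_map_localUnits_eq_zpow`); at a degree-one prime (`e = 1`, the X2 / X11b datum)
  it is `φ(ϖ_v)` = the tree's `heckeValueExtZero φ v`.
* §5 **`tendsto_symm_valueAtUniformizer_mul_zpow_of_uniform`** / `…_of_tendsto_generator` — along a
  sequence `(φ_k, n_k, r_k)` of everywhere-unramified characters of type `(n_k, −n_k)` with avatars
  `r_k → 1` UNIFORMLY on `Γ_K` (which `PNewDisplay.eventually_forall_norm_avatarValueAt_sub_one_lt`
  derives from `r_k(γ) → 1` through a `ℤ_p`-extension `κ`):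
  `ι⁻¹(φ_k(ϖ_𝔭))^{e} · p^{−n_k S} → 1` in `ℂ_p`, and at `e(𝔭|p) = 1`: `ι⁻¹(φ_k(ϖ_𝔭)) · p^{−n_k S} → 1`.
  The `p`-power is GEOMETRIC (an `n_k`-th power of the constant `p^{−S}`, absorbed by a virtual
  period in the rescale); the unit part tends to `1`.

Consumer: the kernel rescale of COMMISSION (O2)-LZZ@3 (cgshw MEMO-18 §5 lemma 3): the factor
`ε_k⁻¹ = −a_p/φ_k(ϖ_𝔭)` of `R_k = display_k/𝓛(χ_k)` is `(geometric) × (→ 1)`; the same lemma at `𝔭̄` and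
at the places of LZZ's `t_±` covers every other non-geometric `k`-dependence. Theorems only.

References: [SerreAbelianLadic1968] Ch. II §2.7, Ch. III §2.3; [NeukirchANT1999] Ch. VI §5 (5.6);
[SerreLocalFields1979] Ch. XIII §4 Thm. 2; [LiuZhangZhang2018] Thm. 3.2.10 (Duke; arXiv Thm. 3.8) — the
formula whose `ε`-factor at `𝔭` this lemma serves (nothing of it asserted here).
-/

noncomputable section

namespace Summit.BirchSwinnertonDyer.Rank1Residual.X2

open scoped Classical MatrixGroups NumberField Topology Polynomial
open Filter NumberField IsDedekindDomain IsDedekindDomain.HeightOneSpectrum Field Polynomial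
open Literature Literature.NumberTheory.EllipticCurves Literature.NumberTheory.GaloisRepresentations
open Literature.NumberTheory.Automorphic

set_option autoImplicit false

namespace PNewDisplay

variable {p : ℕ} [Fact p.Prime] {K : Type} [Field K] [NumberField K]

/-! ### §1 `Ψ_r = ψ_p⁻¹` for any `p`-adic avatar of an algebraic Hecke character -/

section AnyAvatar

/-- `f⁻¹ x = (f x)⁻¹` for continuous monoid homs into a commutative group (definitional). [folklore] -/
private theorem cmh_inv_apply' {G H : Type*} [Monoid G] [TopologicalSpace G] [CommGroup H]
    [TopologicalSpace H] [IsTopologicalGroup H] (f : G →ₜ* H) (x : G) : f⁻¹ x = (f x)⁻¹ := rfl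

/-- **`Ψ_r = ψ_p⁻¹` for ANY `p`-adic avatar.** Let `φ` be a Hecke character of infinity type `(p, q)`,
unramified outside the finite set `T`, and `r : Γ_K → GL₁(ℚ̄_p)` an avatar of `φ` in the tree's sense
(`IsPAdicAvatarOf ι φ r`: unramified at `v ∤ p` where `φ` is, with `r(Frob_v) = ι⁻¹(φ(ϖ_v))⁻¹`). Then
every idelic character `Ψ` of `r` with the clauses of `FramedGaloisRep.exists_idelicCharacter` (trivial
on `Kˣ`; at the unramified places of `r` it kills `𝒪_vˣ` and `r(Frob_v) = Ψ(⟨ϖ_v⟩_v)`) is the INVERSE of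
Weil's `p`-adic avatar `ψ_p` of `φ` (`HasInfinityType.lAdicAvatar`): both are trivial on `Kˣ` and they
are inverse to each other on `K_wˣ` for every `w ∉ T`, `w ∤ p`, so the rigidity of idele class characters
(`ContinuousMonoidHom.idele_eq_of_forall_localUnits`) applies. This is the tree's
`HasInfinityType.eq_lAdicAvatar_inv` (there for Weil's own character) with the Frobenius clause read
off `IsPAdicAvatarOf`. [cite: SerreAbelianLadic1968, Ch. II §2.7, Ch. III §2.3] -/
theorem eq_lAdicAvatar_inv_of_isPAdicAvatarOf {φ : HeckeCharacter K} {pp qq : InfinitePlace K → ℤ}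
    (hinf : φ.HasInfinityType pp qq) (ι : PadicAlgCl p ≃+* ℂ)
    {T : Finset (HeightOneSpectrum (𝓞 K))} (hT : ∀ w, w ∉ T → φ.IsUnramifiedAt w)
    {r : FramedGaloisRep K (PadicAlgCl p) 1} (hav : IsPAdicAvatarOf ι φ r)
    {Ψ : ideleGroup K →ₜ* (PadicAlgCl p)ˣ} (hΨK : ∀ x ∈ principalIdeles K, Ψ x = 1)
    (hΨ : ∀ v : HeightOneSpectrum (𝓞 K), r.IsUnramifiedAt v →
      (∀ u : (v.adicCompletionIntegers K)ˣ,
          Ψ (localUnits v (Units.map ((v.adicCompletionIntegers K).subtype : _ →* _) u)) = 1) ∧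
      ∀ ϖ : (v.adicCompletion K)ˣ, Valued.v (ϖ : v.adicCompletion K) = WithZero.exp (-1 : ℤ) →
        r.HasFrobCharpolyAt v (X - C ((Ψ (localUnits v ϖ) : (PadicAlgCl p)ˣ) : PadicAlgCl p))) :
    Ψ = (hinf.lAdicAvatar ι)⁻¹ := by
  classical
  refine ContinuousMonoidHom.idele_eq_of_forall_localUnits Ψ _ hΨK
    (fun x hx => by
      rw [cmh_inv_apply', hinf.lAdicAvatar_apply, HeckeCharacter.lAdicAvatarHom_eq_one_of_mem ι hx,
        inv_one])
    (S := T ∪ HeckeCharacter.placesAbove K p) fun w hw z => ?_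
  rw [Finset.mem_union, not_or, HeckeCharacter.mem_placesAbove_iff] at hw
  obtain ⟨hwT, hwℓ⟩ := hw
  have hunr : r.IsUnramifiedAt w := (hav w hwℓ (hT w hwT)).1
  -- the valuation of `z`
  have hz0 : Valued.v (z : w.adicCompletion K) ≠ 0 := (Valuation.ne_zero_iff _).mpr z.ne_zero
  set m : ℤ := -WithZero.log (Valued.v (z : w.adicCompletion K)) with hm
  have hz : Valued.v (z : w.adicCompletion K) = WithZero.exp (-m) := by
    rw [hm, neg_neg, WithZero.exp_log hz0]
  -- `Ψ(⟨ϖ⟩) = ι⁻¹(φ(ϖ_w))⁻¹` by comparing Frobenius characteristic polynomials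
  set ϖ : (w.adicCompletion K)ˣ := HeckeCharacter.uniformizer K w with hϖ
  have hϖv : Valued.v (ϖ : w.adicCompletion K) = WithZero.exp (-1 : ℤ) :=
    HeckeCharacter.valued_uniformizer w
  have hΨϖ : (Ψ (localUnits w ϖ) : PadicAlgCl p) = (ι.symm (φ.valueAtUniformizer w))⁻¹ := by
    obtain ⟨𝔓, h𝔓⟩ := w.primesAbove_nonempty
    obtain ⟨Φ, hΦ⟩ := HeightOneSpectrum.exists_isArithFrobAt_of_mem_primesAbove_holds h𝔓
    have h1 := (FramedGaloisRep.hasFrobCharpolyAt_iff_of_rank_one _ w _).mp ((hΨ w hunr).2 ϖ hϖv)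
      𝔓 h𝔓 Φ hΦ
    have h2 := (FramedGaloisRep.hasFrobCharpolyAt_iff_of_rank_one _ w _).mp
      (hav w hwℓ (hT w hwT)).2 𝔓 h𝔓 Φ hΦ
    rw [← h1, h2]
  -- `z = (z ϖ^{-m}) ϖ^m` with `z ϖ^{-m} ∈ 𝒪_wˣ`
  have hu : Valued.v ((z * ϖ ^ (-m) : (w.adicCompletion K)ˣ) : w.adicCompletion K) = 1 := by
    rw [Units.val_mul, Units.val_zpow_eq_zpow_val, map_mul, map_zpow₀, hz, hϖv, ← WithZero.exp_zsmul,
      smul_eq_mul, ← WithZero.exp_add]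
    convert WithZero.exp_zero using 2
    ring
  obtain ⟨u, hu'⟩ := HeckeCharacter.exists_unitsMap_eq_of_valued_eq_one _ hu
  have hsplit : z = (z * ϖ ^ (-m)) * ϖ ^ m := by
    rw [mul_assoc, ← zpow_add, neg_add_cancel, zpow_zero, mul_one]
  -- the `Ψ` side
  have hΨz : (Ψ (localUnits w z) : PadicAlgCl p) = ((ι.symm (φ.valueAtUniformizer w)) ^ m)⁻¹ := by
    rw [hsplit, map_mul, map_mul, ← hu', (hΨ w hunr).1 u, one_mul, map_zpow, map_zpow,
      Units.val_zpow_eq_zpow_val, hΨϖ, inv_zpow]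
  -- the avatar side
  have hAz : (((hinf.lAdicAvatar ι)⁻¹ (localUnits w z) : (PadicAlgCl p)ˣ) : PadicAlgCl p) =
      ((ι.symm (φ.valueAtUniformizer w)) ^ m)⁻¹ := by
    rw [cmh_inv_apply', Units.val_inv_eq_inv_val, hinf.lAdicAvatar_apply,
      HeckeCharacter.coe_lAdicAvatarHom_localUnits_of_not_mem ι hwℓ,
      (hT w hwT).coe_map_localUnits_eq_zpow z hz, map_zpow₀]
  exact Units.ext (hΨz.trans hAz.symm)

/-! ### §2 Local–global compatibility at `v ∣ p` for any avatar -/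

/-- **The avatar above `p`, explicitly, for ANY avatar.** For `φ` of infinity type `(p, q)` unramified
outside `T`, an avatar `r` of `φ` (`IsPAdicAvatarOf ι φ r`), a place `v ∣ p`, a local Artin map `a` of
`K_v` (characterising clauses `IsLocalArtinMap`) and `w ∈ W_{K_v}`:
`r(res_v w) = ι⁻¹(φ(⟨a w⟩_v)) · ∏_{e : K_v → ℚ̄_p} e(a w)^{−n_{ι∘e∘ι_v}}` — Serre's «`ρ_ℓ` is locally
algebraic, the associated algebraic morphism being `x ↦ ∏_σ σ(x)^{−n_σ}`», transported from Weil's own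
character (`HasInfinityType.weilRep_toAbsGalois_apply`) to `r` through its idelic character with
local–global compatibility at EVERY place (`FramedGaloisRep.exists_idelicCharacter_localGlobal`) and §1.
[cite: SerreAbelianLadic1968, Ch. III §2.3, Ch. III §1.1] [cite: NeukirchANT1999, Ch. VI §5 Prop. (5.6)] -/
theorem avatar_entry_eq_of_isPAdicAvatarOf {φ : HeckeCharacter K} {pp qq : InfinitePlace K → ℤ}
    (hinf : φ.HasInfinityType pp qq) (ι : PadicAlgCl p ≃+* ℂ)
    {T : Finset (HeightOneSpectrum (𝓞 K))} (hT : ∀ w, w ∉ T → φ.IsUnramifiedAt w)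
    {r : FramedGaloisRep K (PadicAlgCl p) 1} (hav : IsPAdicAvatarOf ι φ r)
    {v : HeightOneSpectrum (𝓞 K)} (hv : ((p : ℕ) : 𝓞 K) ∈ v.asIdeal)
    (a : WeilGroup (v.adicCompletion K) →* (v.adicCompletion K)ˣ)
    (ha : IsLocalArtinMap (v.adicCompletion K) a) (w : WeilGroup (v.adicCompletion K)) :
    ((r (absGaloisRestrict K (v.adicCompletion K) (WeilGroup.toAbsGalois (v.adicCompletion K) w)) :
        GL (Fin 1) (PadicAlgCl p)) : Matrix (Fin 1) (Fin 1) (PadicAlgCl p)) 0 0 =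
      ι.symm (φ (localUnits v (a w)) : ℂ) *
        ∏ f : {e : v.adicCompletion K →+* PadicAlgCl p // Continuous e},
          f.1 ((a w : (v.adicCompletion K)ˣ) : v.adicCompletion K) ^
            (-HeckeCharacter.embExponent pp qq
              ((ι : PadicAlgCl p →+* ℂ).comp (f.1.comp (algebraMap K (v.adicCompletion K))))) := by
  obtain ⟨Ψ, hΨK, hΨunr, hΨloc⟩ := FramedGaloisRep.exists_idelicCharacter_localGlobal r
  have hΨ := eq_lAdicAvatar_inv_of_isPAdicAvatarOf hinf ι hT hav hΨK hΨunr
  have h := hΨloc v a ha w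
  rw [hΨ, cmh_inv_apply'] at h
  have h' := congrArg (fun u : (PadicAlgCl p)ˣ => (u : PadicAlgCl p)) (inv_injective h).symm
  simp only [FramedRep.det_apply, Matrix.GeneralLinearGroup.val_det_apply, Matrix.det_fin_one] at h'
  rw [h', hinf.lAdicAvatar_apply, HeckeCharacter.coe_lAdicAvatarHom_apply, infPart_localUnits, map_one,
    inv_one, mul_one, HeckeCharacter.coe_algPart_localUnits ι hv]

end AnyAvatar

/-! ### §3 The avatar at a Weil element over `p ∈ K_vˣ`: `r(σ₀) = ι⁻¹(φ(⟨p⟩_v)) · p^{−n S}` -/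

section AtP

/-- `∏_i a^{f i} = a^{Σ_i f i}` for integer exponents and `a ≠ 0` in a field. [folklore] -/
private theorem prod_zpow_eq_zpow_sum' {F : Type*} [Field F] {ι' : Type*} (s : Finset ι') (f : ι' → ℤ)
    {a : F} (ha : a ≠ 0) : ∏ i ∈ s, a ^ f i = a ^ ∑ i ∈ s, f i := by
  classical
  induction s using Finset.induction_on with
  | empty => simp
  | insert i s hi ih => rw [Finset.prod_insert hi, Finset.sum_insert hi, ih, zpow_add₀ ha]

omit [NumberField K] in
/-- For the infinity type `(n, −n)` (constant `n` at every place, `−n` on the conjugates) the exponent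
of every complex embedding is `n` times the exponent of the type `(1, −1)` — a SIGN `±1` (or `0` at a
real embedding) depending on the embedding only. [folklore] -/
theorem embExponent_const_eq_mul (n : ℤ) (τ : K →+* ℂ) :
    HeckeCharacter.embExponent (fun _ : InfinitePlace K ↦ n) (fun _ ↦ -n) τ =
      n * HeckeCharacter.embExponent (fun _ : InfinitePlace K ↦ (1 : ℤ)) (fun _ ↦ (-1 : ℤ)) τ := by
  have h1 : (fun _ : InfinitePlace K ↦ n) = n • (fun _ : InfinitePlace K ↦ (1 : ℤ)) := by
    funext w; simp
  have h2 : (fun _ : InfinitePlace K ↦ -n) = n • (fun _ : InfinitePlace K ↦ (-1 : ℤ)) := by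
    funext w; simp
  rw [h1, h2, HeckeCharacter.embExponent_zsmul]

/-- **The avatar at a fixed Weil element over `p`.** At a place `v ∣ p` there are a FIXED `σ₀ ∈ Γ_K`
(the restriction of a Weil element `w₀` of `K_v` with `a(w₀) = p` for a local Artin map `a` — the
Artin map is onto `K_vˣ`), a FIXED integer `S` (the sum over the continuous embeddings
`e : K_v → ℚ̄_p` of the signs `n_{ι∘e∘ι_v} ∈ {±1}` of the type `(1, −1)`; depends on `ι` and `v` only)
and the unit `z = p ∈ K_vˣ`, such that for EVERY everywhere-unramified Hecke character `φ` of infinity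
type `(n, −n)` and EVERY `p`-adic avatar `r` of `φ`:
`r(σ₀) = ι⁻¹(φ(⟨p⟩_v)) · p^{−n·S}` in `ℂ_p` — §2 at `w₀`, every local embedding sending `p ↦ p`.
Sign-free: no identification of the local embedding with a complex embedding is used.
[cite: SerreAbelianLadic1968, Ch. III §2.3] [cite: SerreLocalFields1979, Ch. XIII §4 Thm. 2] -/
theorem exists_avatarValueAt_eq_symm_map_localUnits_mul_zpow (ι : PadicAlgCl p ≃+* ℂ)
    {v : HeightOneSpectrum (𝓞 K)} (hv : ((p : ℕ) : 𝓞 K) ∈ v.asIdeal) :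
    ∃ (σ₀ : absoluteGaloisGroup K) (S : ℤ) (z : (v.adicCompletion K)ˣ),
      (z : v.adicCompletion K) = algebraMap K (v.adicCompletion K) (p : K) ∧
      ∀ (φ : HeckeCharacter K) (n : ℕ) (r : FramedGaloisRep K (PadicAlgCl p) 1),
        (∀ w : HeightOneSpectrum (𝓞 K), φ.IsUnramifiedAt w) →
        φ.HasInfinityType (fun _ ↦ (n : ℤ)) (fun _ ↦ -(n : ℤ)) → IsPAdicAvatarOf ι φ r →
        avatarValueAt r σ₀ =
          ((ι.symm (φ (localUnits v z) : ℂ) : PadicAlgCl p) : ℂ_[p]) * (p : ℂ_[p]) ^ (-((n : ℤ) * S)) := by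
  classical
  obtain ⟨a, ha⟩ := exists_isLocalArtinMap_holds (v.adicCompletion K)
  have hp : p.Prime := Fact.out
  have hp0 : algebraMap K (v.adicCompletion K) (p : K) ≠ 0 := by
    rw [_root_.map_ne_zero]; exact_mod_cast hp.ne_zero
  set z : (v.adicCompletion K)ˣ := Units.mk0 _ hp0 with hz
  obtain ⟨w₀, hw₀⟩ := ha.isOpenQuotientMap_artin.surjective z
  set s : {e : v.adicCompletion K →+* PadicAlgCl p // Continuous e} → ℤ := fun f ↦
    HeckeCharacter.embExponent (fun _ : InfinitePlace K ↦ (1 : ℤ)) (fun _ ↦ (-1 : ℤ))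
      ((ι : PadicAlgCl p →+* ℂ).comp (f.1.comp (algebraMap K (v.adicCompletion K)))) with hs
  refine ⟨absGaloisRestrict K (v.adicCompletion K) (WeilGroup.toAbsGalois (v.adicCompletion K) w₀),
    ∑ f, s f, z, rfl, fun φ n r hunr hinf hav ↦ ?_⟩
  have hpc : (p : PadicAlgCl p) ≠ 0 := by exact_mod_cast hp.ne_zero
  have hfz : ∀ f : {e : v.adicCompletion K →+* PadicAlgCl p // Continuous e},
      f.1 ((z : (v.adicCompletion K)ˣ) : v.adicCompletion K) = (p : PadicAlgCl p) := by
    intro f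
    rw [hz, Units.val_mk0, map_natCast, map_natCast]
  have hprod : ∏ f : {e : v.adicCompletion K →+* PadicAlgCl p // Continuous e},
      f.1 ((a w₀ : (v.adicCompletion K)ˣ) : v.adicCompletion K) ^
        (-HeckeCharacter.embExponent (fun _ : InfinitePlace K ↦ (n : ℤ)) (fun _ ↦ -(n : ℤ))
          ((ι : PadicAlgCl p →+* ℂ).comp (f.1.comp (algebraMap K (v.adicCompletion K))))) =
      (p : PadicAlgCl p) ^ (-((n : ℤ) * ∑ f, s f)) := by
    rw [Finset.mul_sum, ← Finset.sum_neg_distrib, ← prod_zpow_eq_zpow_sum' _ _ hpc]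
    refine Finset.prod_congr rfl fun f _ ↦ ?_
    rw [hw₀, hfz f, embExponent_const_eq_mul]
  rw [avatarValueAt_eq_entry, avatar_entry_eq_of_isPAdicAvatarOf hinf ι (T := ∅)
    (fun w _ ↦ hunr w) hav hv a ha w₀, hprod, hw₀]
  show algebraMap (PadicAlgCl p) ℂ_[p]
      (ι.symm (φ (localUnits v z) : ℂ) * (p : PadicAlgCl p) ^ (-((n : ℤ) * ∑ f, s f))) =
    algebraMap (PadicAlgCl p) ℂ_[p] (ι.symm (φ (localUnits v z) : ℂ)) *
      (p : ℂ_[p]) ^ (-((n : ℤ) * ∑ f, s f))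
  rw [map_mul, map_zpow₀, map_natCast]

end AtP

/-! ### §4 `⟨p⟩_v` has valuation `q_v^{−e(v|p)}`; the idele value of an unramified character there -/

section Valuation

/-- **`v(p) = q_v^{−e(v|p)}`**: the valuation at `v ∣ p` of the rational prime `p` is
`exp(−e(v|p))` (Mathlib's `valuation_liesOver` — `v_w = v_v^{e}` on the base — over the place of `ℚ`
at `p`, where `p` is a uniformizer). [folklore] -/
theorem valuation_natCast_eq_exp_neg_ramificationIdx {v : HeightOneSpectrum (𝓞 K)}
    (hv : ((p : ℕ) : 𝓞 K) ∈ v.asIdeal) :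
    v.valuation K (p : K) = WithZero.exp (-(v.asIdeal.ramificationIdx (𝓞 ℚ) : ℤ)) := by
  haveI : v.asIdeal.LiesOver (X11b.ratPlace p).asIdeal :=
    ⟨by rw [← X11b.under_eq_ratPlace_of_mem hv]; rfl⟩
  have h := IsDedekindDomain.HeightOneSpectrum.valuation_liesOver (K := ℚ) (L := K)
    (X11b.ratPlace p) v (p : ℚ)
  have hgen : Rat.HeightOneSpectrum.natGenerator (X11b.ratPlace p) = p := X11b.primesEquiv_ratPlace p
  have hval : (X11b.ratPlace p).valuation ℚ (p : ℚ) = WithZero.exp (-1 : ℤ) := by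
    have h1 := Rat.valuation_natGenerator (v := X11b.ratPlace p)
    rwa [hgen] at h1
  rw [map_natCast (algebraMap ℚ K) p,
    Ideal.ramificationIdx'_eq_ramificationIdx _ _ (X11b.ratPlace p).ne_bot] at h
  rw [← h, hval, ← WithZero.exp_nsmul, nsmul_eq_mul, mul_neg, mul_one]

/-- The unit `p ∈ K_vˣ` has valuation `exp(−e(v|p))` in the completion. [folklore] -/
theorem valued_algebraMap_natCast_eq {v : HeightOneSpectrum (𝓞 K)} (hv : ((p : ℕ) : 𝓞 K) ∈ v.asIdeal) :
    Valued.v (algebraMap K (v.adicCompletion K) (p : K)) =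
      WithZero.exp (-(v.asIdeal.ramificationIdx (𝓞 ℚ) : ℤ)) := by
  rw [show algebraMap K (v.adicCompletion K) (p : K) = ((p : K) : v.adicCompletion K) from rfl,
    valuedAdicCompletion_eq_valuation', valuation_natCast_eq_exp_neg_ramificationIdx hv]

/-- **`φ(⟨p⟩_v) = φ(ϖ_v)^{e(v|p)}`** for a Hecke character unramified at `v ∣ p`
(`K_vˣ = ϖ_v^ℤ × 𝒪_vˣ` and `φ_v(𝒪_vˣ) = 1`; Tate's thesis §2.5). [cite: TateThesis1967, §2.5] -/
theorem coe_map_localUnits_natCast_eq_valueAtUniformizer_pow {φ : HeckeCharacter K}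
    {v : HeightOneSpectrum (𝓞 K)} (hv : ((p : ℕ) : 𝓞 K) ∈ v.asIdeal) (hφ : φ.IsUnramifiedAt v)
    {z : (v.adicCompletion K)ˣ} (hz : (z : v.adicCompletion K) = algebraMap K (v.adicCompletion K) (p : K)) :
    (φ (localUnits v z) : ℂ) = φ.valueAtUniformizer v ^ v.asIdeal.ramificationIdx (𝓞 ℚ) := by
  have hval : Valued.v (z : v.adicCompletion K) =
      WithZero.exp (-((v.asIdeal.ramificationIdx (𝓞 ℚ) : ℕ) : ℤ)) := by
    rw [hz, valued_algebraMap_natCast_eq hv]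
  rw [hφ.coe_map_localUnits_eq_zpow z hval, zpow_natCast]

end Valuation

/-! ### §5 The limit `ι⁻¹(φ_k(ϖ_𝔭))^{e} · p^{−n_k S} → 1` along interpolation sequences -/

section Limit

/-- **Along a sequence of everywhere-unramified Hecke characters `φ_k` of infinity type `(n_k, −n_k)`
whose `p`-adic avatars `r_k` tend to `1` UNIFORMLY on `Γ_K`, at a place `𝔭 ∣ p`:
`ι⁻¹(φ_k(ϖ_𝔭))^{e(𝔭|p)} · p^{−n_k·S} → 1` in `ℂ_p`** for the fixed integer `S = S(ι, 𝔭)` of §3 — the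
left side IS `r_k(σ₀)` at the fixed `σ₀` (§3–§4). The `p`-power is geometric (`(p^{−S})^{n_k}`), the rest
is the unit part of `ι⁻¹(φ_k(ϖ_𝔭))`, which therefore tends to `1`.
[cite: SerreAbelianLadic1968, Ch. III §2.3] -/
theorem tendsto_symm_valueAtUniformizer_pow_mul_zpow_of_uniform (ι : PadicAlgCl p ≃+* ℂ)
    {𝔭 : HeightOneSpectrum (𝓞 K)} (h𝔭 : ((p : ℕ) : 𝓞 K) ∈ 𝔭.asIdeal) :
    ∃ S : ℤ, ∀ (φ : ℕ → HeckeCharacter K) (n : ℕ → ℕ) (r : ℕ → FramedGaloisRep K (PadicAlgCl p) 1),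
      (∀ k (w : HeightOneSpectrum (𝓞 K)), (φ k).IsUnramifiedAt w) →
      (∀ k, (φ k).HasInfinityType (fun _ ↦ (n k : ℤ)) (fun _ ↦ -(n k : ℤ))) →
      (∀ k, IsPAdicAvatarOf ι (φ k) (r k)) →
      (∀ ε : ℝ, 0 < ε → ∀ᶠ k in atTop, ∀ σ : absoluteGaloisGroup K, ‖avatarValueAt (r k) σ - 1‖ < ε) →
      Tendsto (fun k ↦ ((ι.symm ((φ k).valueAtUniformizer 𝔭) : PadicAlgCl p) : ℂ_[p]) ^
          𝔭.asIdeal.ramificationIdx (𝓞 ℚ) * (p : ℂ_[p]) ^ (-((n k : ℤ) * S))) atTop (𝓝 1) := by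
  obtain ⟨σ₀, S, z, hz, hσ₀⟩ := exists_avatarValueAt_eq_symm_map_localUnits_mul_zpow ι h𝔭
  refine ⟨S, fun φ n r hunr htyp hav hunif ↦ ?_⟩
  have hlim : Tendsto (fun k ↦ avatarValueAt (r k) σ₀) atTop (𝓝 1) := by
    rw [Metric.tendsto_nhds]
    intro ε hε
    filter_upwards [hunif ε hε] with k hk
    rw [dist_eq_norm]; exact hk σ₀
  refine hlim.congr fun k ↦ ?_
  rw [hσ₀ (φ k) (n k) (r k) (hunr k) (htyp k) (hav k),
    coe_map_localUnits_natCast_eq_valueAtUniformizer_pow h𝔭 (hunr k 𝔭) hz, map_pow]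
  congr 1
  exact map_pow (algebraMap (PadicAlgCl p) ℂ_[p]) _ _

/-- **At a degree-one prime `𝔭 ∣ p` (`e(𝔭|p) = 1` — the X2 / X11b datum, `p` split in the imaginary
quadratic `K`): `ι⁻¹(φ_k(ϖ_𝔭)) · p^{−n_k·S} → 1`** along every sequence as in
`tendsto_symm_valueAtUniformizer_pow_mul_zpow_of_uniform`. This is lemma 3 AT `𝔭` of the kernel
rescale `lzz_rescale` (cgshw MEMO-18 §5): the Steinberg root number `ε_k = −a_p φ_k(ϖ_𝔭)` of
Liu–Zhang–Zhang's interpolation formula contributes `p^{n_k S}·(→ 1)` — geometric times a unit tending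
to `1`. [cite: SerreAbelianLadic1968, Ch. III §2.3]
[cite: LiuZhangZhang2018, Thm. 3.2.10 (Duke numbering; the ε-factor at 𝔭 this limit serves — nothing of it asserted)] -/
theorem tendsto_symm_valueAtUniformizer_mul_zpow_of_uniform (ι : PadicAlgCl p ≃+* ℂ)
    {𝔭 : HeightOneSpectrum (𝓞 K)} (h𝔭 : ((p : ℕ) : 𝓞 K) ∈ 𝔭.asIdeal)
    (he : 𝔭.asIdeal.ramificationIdx (𝓞 ℚ) = 1) :
    ∃ S : ℤ, ∀ (φ : ℕ → HeckeCharacter K) (n : ℕ → ℕ) (r : ℕ → FramedGaloisRep K (PadicAlgCl p) 1),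
      (∀ k (w : HeightOneSpectrum (𝓞 K)), (φ k).IsUnramifiedAt w) →
      (∀ k, (φ k).HasInfinityType (fun _ ↦ (n k : ℤ)) (fun _ ↦ -(n k : ℤ))) →
      (∀ k, IsPAdicAvatarOf ι (φ k) (r k)) →
      (∀ ε : ℝ, 0 < ε → ∀ᶠ k in atTop, ∀ σ : absoluteGaloisGroup K, ‖avatarValueAt (r k) σ - 1‖ < ε) →
      Tendsto (fun k ↦ ((ι.symm ((φ k).valueAtUniformizer 𝔭) : PadicAlgCl p) : ℂ_[p]) *
          (p : ℂ_[p]) ^ (-((n k : ℤ) * S))) atTop (𝓝 1) := by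
  obtain ⟨S, hS⟩ := tendsto_symm_valueAtUniformizer_pow_mul_zpow_of_uniform ι h𝔭
  refine ⟨S, fun φ n r hunr htyp hav hunif ↦ ?_⟩
  have h := hS φ n r hunr htyp hav hunif
  simpa only [he, pow_one] using h

/-- **The same limit along the tree's interpolation sequences through a `ℤ_p`-extension**: if the
avatars `r_k` factor through `κ` and `r_k(γ) → 1` at a topological generator `γ`, then `r_k → 1`
uniformly on `Γ_K` (`PNewDisplay.eventually_forall_norm_avatarValueAt_sub_one_lt`), so at a degree-one
`𝔭 ∣ p`: `ι⁻¹(φ_k(ϖ_𝔭)) · p^{−n_k·S} → 1`. The shape consumed by a kernel rescale against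
`X2.bdpValueContinuousDisplayAt_of_pointwise` (whose sequences are exactly these).
[cite: SerreAbelianLadic1968, Ch. III §2.3] -/
theorem tendsto_symm_valueAtUniformizer_mul_zpow_of_tendsto_generator (ι : PadicAlgCl p ≃+* ℂ)
    {𝔭 : HeightOneSpectrum (𝓞 K)} (h𝔭 : ((p : ℕ) : 𝓞 K) ∈ 𝔭.asIdeal)
    (he : 𝔭.asIdeal.ramificationIdx (𝓞 ℚ) = 1) {κ : ZpExtension K p} {γ : absoluteGaloisGroup K}
    (hγ : κ.IsTopGenerator γ) :
    ∃ S : ℤ, ∀ (φ : ℕ → HeckeCharacter K) (n : ℕ → ℕ) (r : ℕ → FramedGaloisRep K (PadicAlgCl p) 1),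
      (∀ k (w : HeightOneSpectrum (𝓞 K)), (φ k).IsUnramifiedAt w) →
      (∀ k, (φ k).HasInfinityType (fun _ ↦ (n k : ℤ)) (fun _ ↦ -(n k : ℤ))) →
      (∀ k, IsPAdicAvatarOf ι (φ k) (r k)) → (∀ k, FactorsThroughZp κ (r k)) →
      Tendsto (fun k ↦ avatarValueAt (r k) γ) atTop (𝓝 1) →
      Tendsto (fun k ↦ ((ι.symm ((φ k).valueAtUniformizer 𝔭) : PadicAlgCl p) : ℂ_[p]) *
          (p : ℂ_[p]) ^ (-((n k : ℤ) * S))) atTop (𝓝 1) := by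
  obtain ⟨S, hS⟩ := tendsto_symm_valueAtUniformizer_mul_zpow_of_uniform ι h𝔭 he
  refine ⟨S, fun φ n r hunr htyp hav hfac hlim ↦ hS φ n r hunr htyp hav fun ε hε ↦ ?_⟩
  exact eventually_forall_norm_avatarValueAt_sub_one_lt hγ hfac hlim hε

end Limit

end PNewDisplay

end Summit.BirchSwinnertonDyer.Rank1Residual.X2

end
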